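/-
Copyright (c) 2026. All rights reserved.
Released under Apache 2.0 license as described in the file LICENSE.
Authors: abc-iut cell, seat abc-iut-w5-d200 (gen 5).
-/
import Literature.AnabelianGeometry.AbsoluteAnabelian.MLFGaloisPrimeToPStronglyComplete
import Literature.NumberTheory.GaloisRepresentations.LocalGaloisSolvable
import Mathlib.GroupTheory.Nilpotent

/-!
# Strong completeness of `Γ_F` reduces to the continuity of characters of order `p` of its open subgroups

Let `F` be a non-archimedean local field with residue characteristic `p`, `Γ_F = Gal(F̄/F)` topologically
finitely generated (unconditional in characteristic `0`), `P_F = absWildInertia F ϖ` the wild inertia group.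
By `MLFGaloisTameStronglyComplete.isOpen_of_finiteIndex_of_absWildInertia_le` every finite-index subgroup
containing `P_F` is open.  This proof-only file (0 definitions) isolates what is left of the strong
completeness of `Γ_F` — «every finite-index subgroup of `Γ_F` is open», the `G_k` instance of the
Nikolov–Segal fact consumed by the abc-iut cone (F-1977, GAP row G-L3d2g2-1) — as ONE typed statement:

* `isOpen_of_finiteIndex_of_le_of_isOpen` — transfer of the tame result to open subgroups: a finite-index
  `K ≤ V`, `V` open, with `P_F ∩ V ≤ K` is open (`K = K·P_F ∩ V`);
* `isPGroup_quotient_of_le_absWildInertia` — closed subgroups of `P_F` are pro-`p`;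
* **`forall_finiteIndex_isOpen_iff_index_p`** — `Γ_F` is strongly complete **iff** for every OPEN subgroup
  `V ≤ Γ_F`, every subgroup `V₁ ≤ V` that is normal in `V` of index `[V : V₁] = p` is open (equivalently:
  every abstract epimorphism from an open subgroup of `Γ_F` onto `ℤ/p` is continuous).  Proof of `⇐`:
  strong induction on `[V : N]` for `N` normal in an open `V`; `W = N·(P_F ∩ V) ⊇ P_F ∩ V` is open; if
  `W ≠ V` induct inside `W`; if `W = V` then `V/N` is a finite `p`-group (an abstract finite quotient of the
  pro-`p` group `P_F ∩ V`), so `N` lies in a `V`-normal `V₁` of index `p`, open by hypothesis, and one inducts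
  inside `V₁`.

So the `G_k` instance of F-1977 is EQUIVALENT to a bounded-generation statement for `p`-th powers and
commutators in the finite quotients of the open subgroups of `Γ_F` (Nikolov–Segal, Ann. of Math. 165
(2007), Thm 1.2, at these groups); nothing of it is proved or claimed here.  Nothing here asserts anything
about [IUTchIII] Cor. 3.12.

[cite: SerreLocalFields1979, Ch. IV §2 Cor. 1 and Cor. 3 of Prop. 7] [cite: RibesZalesskii2010, §4.2]
[cite: DDMSAnalyticProP1999, §1.2]
-/

noncomputable section

open Field ValuativeRel
open scoped Pointwise Valued

namespace Literature.AnabelianGeometry.AbsoluteAnabelian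

namespace MLFGaloisTameStronglyComplete

open Literature.NumberTheory.GaloisRepresentations
open Literature.NumberTheory.GaloisRepresentations.IsNonarchimedeanLocalField
open Literature.GroupTheory
open _root_.Topology

universe u

variable {F : Type u} [Field F] [ValuativeRel F] [TopologicalSpace F] [IsNonarchimedeanLocalField F]

/-! ### Transfer to open subgroups -/

variable (F) in
/-- **Tame strong completeness inside an open subgroup**: for `Γ_F` topologically finitely generated, `V`
an open subgroup and `K ≤ V` a finite-index subgroup with `P_F ∩ V ≤ K`, `K` is open
(`K = K·P_F ∩ V`, and `K·P_F ⊇ P_F` is open by `isOpen_of_finiteIndex_of_absWildInertia_le`).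
[cite: SerreLocalFields1979, Ch. IV §2] -/
theorem isOpen_of_finiteIndex_of_le_of_isOpen
    (hG : IsTopologicallyFinitelyGenerated (absoluteGaloisGroup F)) {ϖ : 𝒪[F]} (hϖ : Irreducible ϖ)
    {V K : Subgroup (absoluteGaloisGroup F)} (hV : IsOpen (V : Set (absoluteGaloisGroup F)))
    (hKV : K ≤ V) [K.FiniteIndex] (hPK : absWildInertia F ϖ ⊓ V ≤ K) :
    IsOpen (K : Set (absoluteGaloisGroup F)) := by
  haveI : (absWildInertia F ϖ).Normal := absWildInertia_normal F ϖ
  -- `K ⊔ P_F ⊇ P_F` has finite index, hence is open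
  haveI : (K ⊔ absWildInertia F ϖ).FiniteIndex := Subgroup.finiteIndex_of_le le_sup_left
  have hopen : IsOpen ((K ⊔ absWildInertia F ϖ : Subgroup (absoluteGaloisGroup F)) :
      Set (absoluteGaloisGroup F)) :=
    isOpen_of_finiteIndex_of_absWildInertia_le F hG hϖ _ le_sup_right
  -- `K = (K ⊔ P_F) ⊓ V`
  have heq : (K : Set (absoluteGaloisGroup F)) =
      ((K ⊔ absWildInertia F ϖ : Subgroup (absoluteGaloisGroup F)) : Set (absoluteGaloisGroup F)) ∩
        (V : Set (absoluteGaloisGroup F)) := by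
    apply le_antisymm
    · exact fun x hx => ⟨Subgroup.mem_sup_left hx, hKV hx⟩
    · rintro x ⟨hx, hxV⟩
      rw [Subgroup.mul_normal K (absWildInertia F ϖ)] at hx
      obtain ⟨k, hk, π, hπ, rfl⟩ := hx
      have hπV : π ∈ V := by
        have : k⁻¹ * (k * π) ∈ V := V.mul_mem (V.inv_mem (hKV hk)) hxV
        simpa using this
      exact K.mul_mem hk (hPK ⟨hπ, hπV⟩)
  rw [heq]
  exact hopen.inter hV

/-! ### Closed subgroups of `P_F` are pro-`p` -/

/-- A subgroup `X ≤ P_F` is pro-`p` in the quotient phrasing: quotients of `X` by open normal subgroups of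
`X` are `p`-groups (from `absWildInertia_isProP_holds`). [cite: SerreLocalFields1979, Ch. IV §2 Cor. 3 of Prop. 7] -/
theorem isPGroup_quotient_of_le_absWildInertia {ϖ : 𝒪[F]} (hϖ : Irreducible ϖ)
    {X : Subgroup (absoluteGaloisGroup F)} (hX : X ≤ absWildInertia F ϖ) (U : OpenNormalSubgroup ↥X) :
    IsPGroup (ringChar 𝓀[F]) (↥X ⧸ (U : Subgroup ↥X)) := by
  haveI : CompactSpace (absoluteGaloisGroup F) := absoluteGaloisGroup_compactSpace F
  refine isPGroup_quotient_openNormalSubgroup_of_forall_nhds (fun g W hW => ?_) U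
  obtain ⟨O, hOW, hO, h1O⟩ := mem_nhds_iff.mp hW
  obtain ⟨O', hO', hOO'⟩ := isOpen_induced_iff.mp hO
  have h1O' : (1 : absoluteGaloisGroup F) ∈ O' := by
    have : (1 : ↥X) ∈ Subtype.val ⁻¹' O' := by rw [hOO']; exact h1O
    exact this
  obtain ⟨N, hN⟩ := ProfiniteGrp.exist_openNormalSubgroup_sub_open_nhds_of_one hO' h1O'
  obtain ⟨a, ha⟩ := absWildInertia_isProP_holds F hϖ (hX g.2) (N : Subgroup (absoluteGaloisGroup F))
    N.isOpen'
  refine ⟨a, hOW ?_⟩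
  have : (g ^ ringChar 𝓀[F] ^ a : ↥X) ∈ Subtype.val ⁻¹' O' := by
    show ((g ^ ringChar 𝓀[F] ^ a : ↥X) : absoluteGaloisGroup F) ∈ O'
    rw [Subgroup.coe_pow]
    exact hN ha
  rwa [hOO'] at this

/-- For a CLOSED subgroup `X ≤ P_F` and ANY normal finite-index subgroup `M` of `X` (openness not assumed),
every element of `X` has a `p`-power power in `M` (abstract finite quotients of pro-`p` groups are
`p`-groups, `isPGroup_quotient_of_finiteIndex_of_proP`). [cite: DDMSAnalyticProP1999, §1.2] -/
theorem exists_pow_mem_of_le_absWildInertia {ϖ : 𝒪[F]} (hϖ : Irreducible ϖ)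
    {X : Subgroup (absoluteGaloisGroup F)} (hX : X ≤ absWildInertia F ϖ)
    (hXc : IsClosed (X : Set (absoluteGaloisGroup F))) (M : Subgroup ↥X) [M.Normal] [M.FiniteIndex]
    (x : ↥X) : ∃ k : ℕ, x ^ ringChar 𝓀[F] ^ k ∈ M := by
  haveI : CompactSpace (absoluteGaloisGroup F) := absoluteGaloisGroup_compactSpace F
  haveI : CompactSpace ↥X := ProfiniteSubquotients.compactSpace_of_isClosed hXc
  haveI : Fact (ringChar 𝓀[F]).Prime := ⟨ringChar_residueField_prime (F := F)⟩
  obtain ⟨k, hk⟩ := isPGroup_quotient_of_finiteIndex_of_proP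
    (isPGroup_quotient_of_le_absWildInertia hϖ hX) M (QuotientGroup.mk x)
  exact ⟨k, by rwa [← QuotientGroup.mk_pow, QuotientGroup.eq_one_iff] at hk⟩

/-! ### The reduction -/

variable (F) in
/-- **Strong completeness of `Γ_F` ⟺ continuity of the characters of order `p` of its open subgroups.**
For `Γ_F` topologically finitely generated and `ϖ` a uniformiser: every finite-index subgroup of `Γ_F` is
open iff for every OPEN subgroup `V` every subgroup `V₁ ≤ V` which is normal in `V` with `[V : V₁] = p` is
open.  (`⇒` is trivial; `⇐`: strong induction on `[V : N]` — the finite-index subgroup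
`N ⊔ (P_F ⊓ V) ⊇ P_F ⊓ V` of `V` is open (`isOpen_of_finiteIndex_of_le_of_isOpen`); if it is a proper
subgroup of `V`, induct inside it; otherwise `V/N` is an abstract finite quotient of the pro-`p` group
`P_F ⊓ V`, hence a finite `p`-group, so `N` lies in a `V`-normal subgroup `V₁` of index `p`, open by
hypothesis, and one inducts inside `V₁`; finally a finite-index `K` contains its normal core.)  The
right-hand side is the `ℤ/p`-character case of the Nikolov–Segal theorem for the open subgroups of `Γ_F`;
it is NOT proved here. [cite: SerreLocalFields1979, Ch. IV §2 Cor. 1 and Cor. 3 of Prop. 7]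
[cite: RibesZalesskii2010, §4.2] -/
theorem forall_finiteIndex_isOpen_iff_index_p
    (hG : IsTopologicallyFinitelyGenerated (absoluteGaloisGroup F)) {ϖ : 𝒪[F]} (hϖ : Irreducible ϖ) :
    (∀ K : Subgroup (absoluteGaloisGroup F), K.FiniteIndex → IsOpen (K : Set (absoluteGaloisGroup F))) ↔
      ∀ V V₁ : Subgroup (absoluteGaloisGroup F), IsOpen (V : Set (absoluteGaloisGroup F)) → V₁ ≤ V →
        (∀ v ∈ V, ∀ x ∈ V₁, v * x * v⁻¹ ∈ V₁) → V₁.relIndex V = ringChar 𝓀[F] →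
          IsOpen (V₁ : Set (absoluteGaloisGroup F)) := by
  classical
  haveI : CompactSpace (absoluteGaloisGroup F) := absoluteGaloisGroup_compactSpace F
  set p := ringChar 𝓀[F] with hp
  have hpp : p.Prime := ringChar_residueField_prime (F := F)
  haveI : Fact p.Prime := ⟨hpp⟩
  constructor
  · -- `⇒`: `V₁` has finite index in `Γ_F`
    intro h V V₁ hV hle _ hidx
    haveI : Finite (absoluteGaloisGroup F ⧸ V) := Subgroup.quotient_finite_of_isOpen V hV
    haveI : V.FiniteIndex := Subgroup.finiteIndex_of_finite_quotient
    haveI : V₁.FiniteIndex := by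
      refine ⟨fun h0 => ?_⟩
      have h1 := Subgroup.relIndex_mul_index hle
      rw [h0, hidx] at h1
      rcases mul_eq_zero.mp h1 with h1 | h1
      · exact hpp.ne_zero h1
      · exact Subgroup.FiniteIndex.index_ne_zero h1
    exact h V₁ inferInstance
  · intro hH1
    set P := absWildInertia F ϖ with hPdef
    haveI : P.Normal := absWildInertia_normal F ϖ
    have hPc : IsClosed (P : Set (absoluteGaloisGroup F)) := isClosed_absWildInertia F ϖ
    -- the inductive claim: `N` normal in an open `V`, of relative index `m`, is open
    suffices key : ∀ (m : ℕ) (V N : Subgroup (absoluteGaloisGroup F)),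
        IsOpen (V : Set (absoluteGaloisGroup F)) → N ≤ V → (∀ v ∈ V, ∀ x ∈ N, v * x * v⁻¹ ∈ N) →
          N.FiniteIndex → N.relIndex V = m → IsOpen (N : Set (absoluteGaloisGroup F)) by
      intro K hK
      have hcore : IsOpen ((K.normalCore : Subgroup (absoluteGaloisGroup F)) :
          Set (absoluteGaloisGroup F)) :=
        key _ ⊤ K.normalCore isOpen_univ le_top
          (fun v _ x hx => (Subgroup.normalCore_normal K).conj_mem x hx v) inferInstance rfl
      exact Subgroup.isOpen_mono (Subgroup.normalCore_le K) hcore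
    intro m
    induction m using Nat.strong_induction_on with
    | _ m ih =>
    intro V N hV hNV hNn hNfi hm
    haveI := hNfi
    -- the relative index is positive
    have hm0 : m ≠ 0 := by
      rw [← hm]
      exact Subgroup.FiniteIndex.index_ne_zero
    -- `W = N ⊔ (P ⊓ V)` is an open subgroup of `V` containing `N`
    set W : Subgroup (absoluteGaloisGroup F) := N ⊔ (P ⊓ V) with hW
    have hWV : W ≤ V := sup_le hNV inf_le_right
    have hNW : N ≤ W := le_sup_left
    haveI : W.FiniteIndex := Subgroup.finiteIndex_of_le hNW
    have hWo : IsOpen (W : Set (absoluteGaloisGroup F)) :=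
      isOpen_of_finiteIndex_of_le_of_isOpen F hG hϖ hV hWV (le_sup_right)
    have hNnW : ∀ v ∈ W, ∀ x ∈ N, v * x * v⁻¹ ∈ N := fun v hv x hx => hNn v (hWV hv) x hx
    by_cases hWeq : W = V
    swap
    · -- `W < V`: induct inside `W`
      have hlt : N.relIndex W < m := by
        rw [← hm, ← Subgroup.relIndex_mul_relIndex N W V hNW hWV]
        have h1 : W.relIndex V ≠ 1 := by
          rw [Ne, Subgroup.relIndex_eq_one]
          exact fun h => hWeq (le_antisymm hWV h)
        have h0 : N.relIndex W ≠ 0 := Subgroup.FiniteIndex.index_ne_zero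
        have h0' : W.relIndex V ≠ 0 := Subgroup.FiniteIndex.index_ne_zero
        have h2 : 1 < W.relIndex V := by omega
        exact (lt_mul_iff_one_lt_right (Nat.pos_of_ne_zero h0)).mpr h2
      exact ih _ hlt W N hWo hNW hNnW hNfi rfl
    -- `W = V`: the finite group `V / N` is a `p`-group
    haveI hNVn : (N.subgroupOf V).Normal := by
      refine ⟨fun x hx v => ?_⟩
      rw [Subgroup.mem_subgroupOf] at hx ⊢
      simpa using hNn v v.2 x hx
    haveI : Finite (↥V ⧸ N.subgroupOf V) := Subgroup.finite_quotient_of_finiteIndex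
    -- the closed pro-`p` subgroup `X = P ⊓ V` and its restriction map to `V / N`
    set X : Subgroup (absoluteGaloisGroup F) := P ⊓ V with hX
    have hXc : IsClosed (X : Set (absoluteGaloisGroup F)) :=
      hPc.inter (Subgroup.isClosed_of_isOpen V hV)
    let ι : ↥X →* ↥V := Subgroup.inclusion inf_le_right
    let φ : ↥X →* ↥V ⧸ N.subgroupOf V := (QuotientGroup.mk' (N.subgroupOf V)).comp ι
    -- `φ` is surjective since `N ⊔ X = V` (inside `V`, `N` is normal, so `V = N · X`)
    have hφs : Function.Surjective φ := by
      intro q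
      obtain ⟨v, rfl⟩ := QuotientGroup.mk_surjective q
      have hsup : N.subgroupOf V ⊔ X.subgroupOf V = ⊤ := by
        rw [← Subgroup.subgroupOf_sup hNV inf_le_right, ← hW, hWeq, Subgroup.subgroupOf_self]
      have hv : v ∈ ((N.subgroupOf V ⊔ X.subgroupOf V : Subgroup ↥V) : Set ↥V) := by
        rw [hsup]; exact Subgroup.mem_top v
      rw [Subgroup.normal_mul] at hv
      obtain ⟨n, hn, x, hx, rfl⟩ := hv
      refine ⟨⟨(x : absoluteGaloisGroup F), Subgroup.mem_subgroupOf.mp hx⟩, ?_⟩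
      have hιx : ι ⟨(x : absoluteGaloisGroup F), Subgroup.mem_subgroupOf.mp hx⟩ = x := Subtype.ext rfl
      show QuotientGroup.mk (ι _) = _
      rw [hιx, QuotientGroup.mk_mul, (QuotientGroup.eq_one_iff n).mpr hn, one_mul]
    -- hence `V / N` is a `p`-group
    have hPG : IsPGroup p (↥V ⧸ N.subgroupOf V) := by
      intro q
      obtain ⟨x, rfl⟩ := hφs q
      haveI : φ.ker.Normal := inferInstance
      haveI : φ.ker.FiniteIndex := by
        refine ⟨fun h0 => ?_⟩
        have h := Subgroup.index_ker φ
        rw [h0] at h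
        exact (Nat.card_pos (α := φ.range)).ne' h.symm
      obtain ⟨k, hk⟩ := exists_pow_mem_of_le_absWildInertia hϖ (inf_le_left : X ≤ P) hXc φ.ker x
      exact ⟨k, by rw [← map_pow]; exact (MonoidHom.mem_ker).mp hk⟩
    -- `V / N` is nontrivial (as `m ≠ 1`, i.e. `N ≠ V`) unless `N = V`, which is open
    by_cases hNeqV : N = V
    · rw [hNeqV]; exact hV
    haveI : Nontrivial (↥V ⧸ N.subgroupOf V) := by
      rw [← not_subsingleton_iff_nontrivial]
      intro hsub
      apply hNeqV
      refine le_antisymm hNV fun v hv => ?_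
      have h1 : (QuotientGroup.mk ⟨v, hv⟩ : ↥V ⧸ N.subgroupOf V) = 1 := Subsingleton.elim _ _
      rw [QuotientGroup.eq_one_iff, Subgroup.mem_subgroupOf] at h1
      exact h1
    haveI : IsSolvable (↥V ⧸ N.subgroupOf V) := by
      haveI := hPG.isNilpotent
      infer_instance
    obtain ⟨M, hMn, hMp⟩ := exists_normal_index_prime (R := ↥V ⧸ N.subgroupOf V)
    -- the index of `M` is `p`
    have hMidx : M.index = p := by
      obtain ⟨n, hn⟩ := IsPGroup.iff_card.mp hPG
      have hdvd : M.index ∣ p ^ n := hn ▸ M.index_dvd_card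
      exact (Nat.prime_dvd_prime_iff_eq hMp hpp).mp (hMp.dvd_of_dvd_pow hdvd)
    -- `V₁ ≤ V`: the preimage of `M`
    set V₁ : Subgroup (absoluteGaloisGroup F) :=
      (M.comap (QuotientGroup.mk' (N.subgroupOf V))).map V.subtype with hV₁
    have hV₁V : V₁ ≤ V := by
      rintro _ ⟨y, -, rfl⟩; exact y.2
    have hV₁sub : V₁.subgroupOf V = M.comap (QuotientGroup.mk' (N.subgroupOf V)) := by
      rw [hV₁, Subgroup.subgroupOf, Subgroup.comap_map_eq_self_of_injective]
      exact Subgroup.subtype_injective V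
    have hmemV₁ : ∀ {g : absoluteGaloisGroup F} (hg : g ∈ V),
        g ∈ V₁ ↔ (QuotientGroup.mk ⟨g, hg⟩ : ↥V ⧸ N.subgroupOf V) ∈ M := by
      intro g hg
      have : g ∈ V₁ ↔ (⟨g, hg⟩ : ↥V) ∈ V₁.subgroupOf V := by rw [Subgroup.mem_subgroupOf]
      rw [this, hV₁sub, Subgroup.mem_comap]
      rfl
    have hNV₁ : N ≤ V₁ := by
      intro g hg
      rw [hmemV₁ (hNV hg)]
      have : (QuotientGroup.mk ⟨g, hNV hg⟩ : ↥V ⧸ N.subgroupOf V) = 1 := by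
        rw [QuotientGroup.eq_one_iff, Subgroup.mem_subgroupOf]; exact hg
      rw [this]; exact M.one_mem
    have hV₁n : ∀ v ∈ V, ∀ x ∈ V₁, v * x * v⁻¹ ∈ V₁ := by
      intro v hv x hx
      have hxV : x ∈ V := hV₁V hx
      rw [hmemV₁ (V.mul_mem (V.mul_mem hv hxV) (V.inv_mem hv))]
      have hx' := (hmemV₁ hxV).mp hx
      have hel : (⟨v * x * v⁻¹, V.mul_mem (V.mul_mem hv hxV) (V.inv_mem hv)⟩ : ↥V) =
          ⟨v, hv⟩ * ⟨x, hxV⟩ * ⟨v, hv⟩⁻¹ := rfl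
      rw [hel, QuotientGroup.mk_mul, QuotientGroup.mk_mul, QuotientGroup.mk_inv]
      exact hMn.conj_mem _ hx' (QuotientGroup.mk ⟨v, hv⟩)
    have hV₁idx : V₁.relIndex V = p := by
      rw [Subgroup.relIndex, hV₁sub, Subgroup.index_comap_of_surjective _ (QuotientGroup.mk'_surjective _),
        hMidx]
    -- `V₁` is open by hypothesis, and `[V₁ : N] < [V : N]`
    have hV₁o : IsOpen (V₁ : Set (absoluteGaloisGroup F)) := hH1 V V₁ hV hV₁V hV₁n hV₁idx
    have hNnV₁ : ∀ v ∈ V₁, ∀ x ∈ N, v * x * v⁻¹ ∈ N := fun v hv x hx => hNn v (hV₁V hv) x hx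
    have hlt : N.relIndex V₁ < m := by
      rw [← hm, ← Subgroup.relIndex_mul_relIndex N V₁ V hNV₁ hV₁V, hV₁idx]
      have h0 : N.relIndex V₁ ≠ 0 := Subgroup.FiniteIndex.index_ne_zero
      exact (lt_mul_iff_one_lt_right (Nat.pos_of_ne_zero h0)).mpr hpp.one_lt
    exact ih _ hlt V₁ N hV₁o hNV₁ hNnV₁ hNfi rfl

end MLFGaloisTameStronglyComplete

end Literature.AnabelianGeometry.AbsoluteAnabelian
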